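import Summits.Ventures.PercRepro.ProfileTwoDeletion

/-!
# PercRepro — THE DELETION STEP `STEP′(z)` AT AN ELEMENT IN NO SMALL COCIRCUIT
(p10, gen 3; S5 §2.5 of `proofs/SUBCLAIM-S5-p10.md`)

The first proved case of the deletion step `DelStep M z u` of `ProfileTwoDeletion.lean`: if `M` is simple and
coloop-free and `z` lies in no cocircuit with at most three elements, then `STEP′(z)` holds at every level
`3 ≤ u ≤ ρ(E)`.  Mechanism: every pair `B ∌ z` keeps its demand in `M ∖ z` (its complement in `M ∖ z` still
spans), every pair `{z, w}` demands `C(ρ(E), u−2)`, and the independent `u`-sets through `z` are counted by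
the double count `(u−1) · I_{u−1}(M / z) = Σ_w I_{u−2}(M / {z,w})` with the cogirth-`2` lemma on each
`M / {z, w}` (rank `ρ(E) − 2`, coloop-free): `I_{u−2} ≥ C(ρ(E) − 1, u−2)`.  The binomial inequality
`(u−1) · C(R, u−2) ≤ C(u,2) · C(R−1, u−2)`, i.e. `(u−2)(R−u) ≥ 0`, closes — with slack
`(n−1) · C(R−1, u−3) · (R−u) / 2`.  (The general step — `z` in a series pair or a 3-cocircuit, or `M` with
coloops — is NOT proved here; see the census in `mining/p10/g3/`.)

* `NoSmallCocircuitAt M z` — every `X ∋ z` with `#X ≤ 3` has a spanning complement;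
* `choose_two_mul_choose_pred_ge` — the binomial inequality;
* `card_indepSetsThrough_eq_contract` — `#{S ∈ I_u(M) : z ∈ S} = I_{u−1}(M / z)`;
* **`delStep_of_noSmallCocircuit`** — `STEP′(z)` for such `z`.
-/

open scoped Matroid

namespace PercRepro.Cogirth

open Finset ThmH Skew Shadow Profile

variable {α : Type} [DecidableEq α] {M : Matroid α} [M.Finite]

/-- `z` lies in no cocircuit with at most three elements (spanning form): every subset `X` of the ground
set containing `z` with `#X ≤ 3` has a spanning complement. -/
def NoSmallCocircuitAt (M : Matroid α) [M.Finite] (z : α) : Prop :=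
  ∀ X ⊆ gr M, z ∈ X → X.card ≤ 3 → rk M (gr M \ X) = rk M (gr M)

/-! ### Arithmetic -/

/-- `(u−1) · C(R, u−2) ≤ C(u,2) · C(R−1, u−2)` for `2 ≤ u ≤ R` — i.e. `(u−2)(R−u) ≥ 0`. -/
theorem choose_two_mul_choose_pred_ge {u R : ℕ} (hu : 2 ≤ u) (huR : u ≤ R) :
    (u - 1) * R.choose (u - 2) ≤ u.choose 2 * (R - 1).choose (u - 2) := by
  obtain ⟨a, rfl⟩ : ∃ a, u = a + 2 := ⟨u - 2, by omega⟩
  obtain ⟨b, rfl⟩ : ∃ b, R = a + 2 + b := ⟨R - (a + 2), by omega⟩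
  have e1 : a + 2 - 1 = a + 1 := by omega
  have e2 : a + 2 - 2 = a := by omega
  have e3 : a + 2 + b - 1 = a + 1 + b := by omega
  rw [e1, e2, e3]
  -- `C(a+1+b, a) · (a+2+b) = C(a+2+b, a) · (b+2)`
  have h1 : (a + 1 + b).choose a * (a + 2 + b) = (a + 2 + b).choose a * (b + 2) := by
    have h := Nat.choose_mul_succ_eq (a + 1 + b) a
    have f1 : a + 1 + b + 1 = a + 2 + b := by omega
    have f2 : a + 2 + b - a = b + 2 := by omega
    rw [f1, f2] at h
    exact h
  have h2 : 2 * (a + 2).choose 2 = (a + 2) * (a + 1) := by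
    rw [Nat.choose_two_right]
    have := Nat.two_mul_div_two_of_even (Nat.even_mul_pred_self (a + 2))
    rw [this]
    rfl
  -- multiply the goal by `2 (a + 2 + b) > 0`
  have key : 2 * (a + 2 + b) * ((a + 1) * (a + 2 + b).choose a) ≤
      2 * (a + 2 + b) * ((a + 2).choose 2 * (a + 1 + b).choose a) := by
    have r1 : 2 * (a + 2 + b) * ((a + 2).choose 2 * (a + 1 + b).choose a) =
        (2 * (a + 2).choose 2) * ((a + 1 + b).choose a * (a + 2 + b)) := by ring
    rw [r1, h2, h1]
    have r2 : 2 * (a + 2 + b) * ((a + 1) * (a + 2 + b).choose a) =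
        (a + 1) * (a + 2 + b).choose a * (2 * (a + 2 + b)) := by ring
    have r3 : (a + 2) * (a + 1) * ((a + 2 + b).choose a * (b + 2)) =
        (a + 1) * (a + 2 + b).choose a * ((a + 2) * (b + 2)) := by ring
    rw [r2, r3]
    apply Nat.mul_le_mul_left
    nlinarith [Nat.zero_le (a * b)]
  exact Nat.le_of_mul_le_mul_left key (by omega)

/-! ### Counting through `z` -/

/-- The independent `u`-sets through `z` are counted by the independent `(u−1)`-sets of `M / z`. -/
theorem card_indepSetsThrough_eq_contract (hs : Simple' M) {z : α} (hz : z ∈ gr M) {u : ℕ} (hu : 1 ≤ u) :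
    (indepSetsThrough M u z).card = (indepSets (M ／ ({z} : Set α)) (u - 1)).card := by
  have hz1 : ({z} : Finset α) ∈ indepSets M 1 := by
    rw [mem_indepSets]
    exact ⟨singleton_subset_iff.2 hz, card_singleton z, hs {z} (singleton_subset_iff.2 hz) (by simp)⟩
  have h := card_indepSets_contract_eq hu hz1
  rw [coe_singleton] at h
  rw [h, indepSetsThrough]
  congr 1
  ext S
  simp only [mem_filter, singleton_subset_iff]

/-- The pairs through `z` are counted by the independent singletons of `M / z`. -/
theorem card_pairs_through_eq_contract (hs : Simple' M) {z : α} (hz : z ∈ gr M) :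
    ((indepSets M 2).filter (fun B => z ∈ B)).card = (indepSets (M ／ ({z} : Set α)) 1).card := by
  have h := card_indepSetsThrough_eq_contract hs hz (u := 2) (by norm_num)
  rw [indepSetsThrough] at h
  exact h

/-! ### The step -/

/-- The demand of a pair avoiding `z` is the same in `M` and in `M ∖ z` when `z` lies in no cocircuit of
size `≤ 3`. -/
theorem demand_delete_eq_of_noSmallCocircuit {z : α} (hz : z ∈ gr M) (hzc : NoSmallCocircuitAt M z)
    {u : ℕ} {B : Finset α} (hB : B ∈ indepSets M 2) (hzB : z ∉ B) :
    demand (M ＼ ({z} : Set α)) 2 u B = demand M 2 u B := by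
  rw [mem_indepSets] at hB
  have hsub : insert z B ⊆ gr M := insert_subset hz hB.1
  have hcard : (insert z B).card ≤ 3 := by
    rw [card_insert_of_notMem hzB, hB.2.1]
  have hfull : rk M (gr M \ insert z B) = rk M (gr M) := hzc _ hsub (mem_insert_self z B) hcard
  have hB' : rk M (gr M \ B) = rk M (gr M) := by
    apply le_antisymm (rk_mono' sdiff_subset)
    rw [← hfull]
    exact rk_mono' (sdiff_subset_sdiff (subset_refl _) (subset_insert z B))
  have hdel : rk (M ＼ ({z} : Set α)) (gr (M ＼ ({z} : Set α)) \ B) = rk M (gr M) := by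
    rw [gr_delete', rk_delete (sdiff_subset), erase_sdiff_comm, ← sdiff_insert, hfull]
  unfold demand
  rw [hdel, hB']

/-- **`STEP′(z)` at an element in no small cocircuit.**  `M` simple and coloop-free (`CogirthGe' M 2`),
`z` in no cocircuit with `≤ 3` elements, `3 ≤ u ≤ ρ(E)`: then `DelStep M z u`. -/
theorem delStep_of_noSmallCocircuit (hs : Simple' M) (hg : CogirthGe' M 2) {z : α} (hz : z ∈ gr M)
    (hzc : NoSmallCocircuitAt M z) {u : ℕ} (hu : 3 ≤ u) (huR : u ≤ rk M (gr M)) : DelStep M z u := by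
  classical
  unfold DelStep
  set R := rk M (gr M) with hR
  -- split the demand of `M` at `z`
  rw [← sum_filter_add_sum_filter_not (indepSets M 2) (fun B => z ∈ B)]
  -- the pairs avoiding `z`: same demand as in `M ∖ z`
  have hA : ∑ B ∈ (indepSets M 2).filter (fun B => ¬ z ∈ B), demand M 2 u B =
      ∑ B ∈ indepSets (M ＼ ({z} : Set α)) 2, demand (M ＼ ({z} : Set α)) 2 u B := by
    rw [indepSets_delete_eq_filter]
    apply sum_congr rfl
    intro B hB
    rw [mem_filter] at hB
    exact (demand_delete_eq_of_noSmallCocircuit hz hzc hB.1 hB.2).symm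
  -- the pairs through `z`: demand `C(R, u−2)` each
  have hBz : ∀ B ∈ (indepSets M 2).filter (fun B => z ∈ B), demand M 2 u B = R.choose (u - 2) := by
    intro B hB
    rw [mem_filter, mem_indepSets] at hB
    have hfull : rk M (gr M \ B) = rk M (gr M) := hzc B hB.1.1 hB.2 (by rw [hB.1.2.1]; norm_num)
    unfold demand
    rw [hfull, if_pos huR]
  rw [sum_const_nat hBz, hA, card_pairs_through_eq_contract hs hz,
    card_indepSetsThrough_eq_contract hs hz (by omega)]
  -- the count of independent `(u−1)`-sets of `N = M / z` through the double count
  have hzi : M.Indep (({z} : Finset α) : Set α) := hs {z} (singleton_subset_iff.2 hz) (by simp)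
  have hNg : CogirthGe' (M ／ ({z} : Set α)) 2 := by
    have h := cogirthGe'_contract' hg (B := {z}) (singleton_subset_iff.2 hz)
    rwa [coe_singleton] at h
  have hNrank : rk (M ／ ({z} : Set α)) (gr (M ／ ({z} : Set α))) + 1 = R := by
    have h := rk_gr_contract_add_card (M := M) (B := {z}) hzi (singleton_subset_iff.2 hz)
    rw [card_singleton, coe_singleton] at h
    exact h
  have hdc := sum_card_indepSets_contract (M := M ／ ({z} : Set α)) (q := 1) (u := u - 1) (by omega)
  -- each `N / {w}` has rank `R − 2` and cogirth `≥ 2`: at least `C(R−1, u−2)` independent `(u−2)`-sets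
  have hterm : ∀ B ∈ indepSets (M ／ ({z} : Set α)) 1,
      (R - 1).choose (u - 2) ≤ (indepSets ((M ／ ({z} : Set α)) ／ (B : Set α)) (u - 1 - 1)).card := by
    intro B hB
    have hB' := hB
    rw [mem_indepSets] at hB'
    have hrk : rk ((M ／ ({z} : Set α)) ／ (B : Set α)) (gr ((M ／ ({z} : Set α)) ／ (B : Set α))) + 1 = rk (M ／ ({z} : Set α)) (gr (M ／ ({z} : Set α))) := by
      have h := rk_gr_contract_add_card hB'.2.2 hB'.1
      rwa [hB'.2.1] at h
    have hg2 : CogirthGe ((M ／ ({z} : Set α)) ／ (B : Set α)) 2 := cogirthGe_of_cogirthGe' (cogirthGe'_contract' hNg hB'.1)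
    have h := choose_le_card_indepSets (M := (M ／ ({z} : Set α)) ／ (B : Set α)) (g := 2) (by norm_num) hg2
      (j := u - 1 - 1) (by omega)
    have e : rk ((M ／ ({z} : Set α)) ／ (B : Set α)) (gr ((M ／ ({z} : Set α)) ／ (B : Set α))) + 2 - 1 = R - 1 := by omega
    have e' : u - 1 - 1 = u - 2 := by omega
    rw [e, e'] at h
    rw [e']
    exact h
  have hsum : (indepSets (M ／ ({z} : Set α)) 1).card * (R - 1).choose (u - 2) ≤ (indepSets (M ／ ({z} : Set α)) (u - 1)).card * (u - 1) := by
    calc (indepSets (M ／ ({z} : Set α)) 1).card * (R - 1).choose (u - 2)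
        = ∑ B ∈ indepSets (M ／ ({z} : Set α)) 1, (R - 1).choose (u - 2) := by rw [sum_const, smul_eq_mul]
      _ ≤ ∑ B ∈ indepSets (M ／ ({z} : Set α)) 1, (indepSets ((M ／ ({z} : Set α)) ／ (B : Set α)) (u - 1 - 1)).card := sum_le_sum hterm
      _ = (indepSets (M ／ ({z} : Set α)) (u - 1)).card * (u - 1).choose 1 := hdc
      _ = (indepSets (M ／ ({z} : Set α)) (u - 1)).card * (u - 1) := by rw [Nat.choose_one_right]
  -- the binomial inequality closes
  have hbin := choose_two_mul_choose_pred_ge (by omega : 2 ≤ u) huR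
  have hfin : (u - 1) * ((indepSets (M ／ ({z} : Set α)) 1).card * R.choose (u - 2)) ≤
      (u - 1) * (u.choose 2 * (indepSets (M ／ ({z} : Set α)) (u - 1)).card) := by
    calc (u - 1) * ((indepSets (M ／ ({z} : Set α)) 1).card * R.choose (u - 2))
        = (indepSets (M ／ ({z} : Set α)) 1).card * ((u - 1) * R.choose (u - 2)) := by ring
      _ ≤ (indepSets (M ／ ({z} : Set α)) 1).card * (u.choose 2 * (R - 1).choose (u - 2)) :=
          Nat.mul_le_mul_left _ hbin
      _ = u.choose 2 * ((indepSets (M ／ ({z} : Set α)) 1).card * (R - 1).choose (u - 2)) := by ring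
      _ ≤ u.choose 2 * ((indepSets (M ／ ({z} : Set α)) (u - 1)).card * (u - 1)) := Nat.mul_le_mul_left _ hsum
      _ = (u - 1) * (u.choose 2 * (indepSets (M ／ ({z} : Set α)) (u - 1)).card) := by ring
  have hmain : (indepSets (M ／ ({z} : Set α)) 1).card * R.choose (u - 2) ≤ u.choose 2 * (indepSets (M ／ ({z} : Set α)) (u - 1)).card :=
    Nat.le_of_mul_le_mul_left hfin (by omega)
  omega

end PercRepro.Cogirth
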